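import Literature.MathematicalPhysics.QuantumFieldTheory.Balaban1983to89.B15Prop1EndpointNearFlatLettersWindow
import Literature.MathematicalPhysics.QuantumFieldTheory.Balaban1983to89.B16Ineq17NearFlatDatumFamilyB
import Literature.MathematicalPhysics.QuantumFieldTheory.Balaban1983to89.B15Prop1RealChartFamilySupportB
import Literature.MathematicalPhysics.QuantumFieldTheory.Balaban1983to89.B15Prop1CoerciveAtNormalisedDatumB
import Literature.MathematicalPhysics.QuantumFieldTheory.Balaban1983to89.B15Prop1SliceHessianOfChartFamilyB

/-!
# `Balaban1983to89.B15Prop1EndpointNearFlatLettersWindow` — [Balaban1989LargeFieldII] = «[LF-II]», p. 357, (1.7)–(1.9) p. 358, (1.12)–(1.13) p. 359; [Balaban1989LargeFieldI] = «[IV]», — **BOND-DATUM EDITION** (`…B15Prop1EndpointNearFlatLettersWindowB`, USED DECLARATIONS ONLY): the print-datum ([Balaban1984PropagatorsII] (2.3)) twins of the declarations of `B15Prop1EndpointNearFlatLettersWindow` that N12's junction of record v14ᴸ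
uses with a datum-bearing statement (`triple_of_contDiffAt_two`, `h17Clause_of_windowLetters_direct`, `sliceCoercive_of_windowLetters_direct`, `hcoer_of_windowLettersDirect_normalised_box`) — class (γ) of dag-n12-c's census-by-declaration v2 (bus [DAGN12C-G35], 2026-08-30).  GENERATOR (block-extracted from the
parent's tree bytes by HOME `lean/g35/gen/gen_blocks.py`): namespace `…B`, SAME names, `DetSet ↦ BDetSet` (F0a), `AgreeOn ↦ AgreeOnB`, `IsMinimizer ↦ IsMinimizerB`, `bondsOf (𝐁 j) ↦ 𝔅 j`, `constrCard ∕
constrEnum ∕ ConstrSet ∕ msChart ↦ …B` (lane `Node00/MultiScaleFibreChartB`), `IsCritOnFibre ∕ IsFibreChartNear ↦ …B`; proofs VERBATIM; the parent's other (datum-free) declarations REUSED by `open`.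
RE-KEY NOTE (this file changes SHAPES, not only names — for the junction's generator, dag-n12-d): (1) the determining set is print's bond-datum FAMILY `bd : ℕ → (ℕ → Set (Site P 0)) →
BDetSet P` read at `bd k (maxDomT ν.M₁ Z)` (binder `(bd)` right after `hk`; `msChart ∕ constrCard ↦ msChartB ∕ constrCardB`, `fun177std (bgMSCoPOfRecord …) ν.M₁ Z k ↦ fun177stdB
(bgMSCoPOfRecordB …) ν.M₁ bd Z k`); (2) the SUPPORT SET of the (K′) family's velocity is DISPLAYED: binders `(S : Set (PBond (F.P Kt) 0)) (hS : ∀ b ∉ S, b ∈ bd k (maxDomT ν.M₁ Z) 0)`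
before `hfar`, and `hfar`, P1's plaquette set (`hPfar`) and `hsupp` read `S` where the parent read `{b | b.src ∈ maxDomT ν.M₁ Z 1}` — over the tree's site-level `𝐁_k(Z)` every bond
MEETING `Ω₁(Z)ᶜ` is pinned (`Bj_zero`), over print's [II] (2.3) datum only the bonds with BOTH endpoints off `Ω₁(Z)` are (`B15Prop1GradientFromNearValueB.mem_lamDatumP_maxDomT_zero_of_not_mem₂`),
so at the junction `S := {b | b₋ ∈ Ω₁(Z) ∨ b₊ ∈ Ω₁(Z)}` (P1 is then asked on the plaquettes with a VERTEX in `Ω₁(Z)`); (3) `hk0 : 0 < k` is GONE (it served `Bj_zero` only); (4) the family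
letter `hcoer_of_windowLettersDirect_normalised_box` gains `(hbd : ∀ i j, m + K < j → bd (k i) (maxDomT ν.M₁ (Z i)) j = ∅)` (the range clause of ✓p770611) and `(S) (hS)` per instance.

statement-level skeleton of published theorems with citation tags; proofs where landed; nothing here is a claim about the Yang–Mills mass gap

Cell `pub-ymgap` (HUMAN RULINGS D-0062 ∕ D-0149), lane `pub-ymgap-dag-n12-c` g35 (R134 seat (a), N12 = [B15], s1, lane owner); `--kind proof --supports` K1⁹ `stmt-QuantumFields-27364`; count-neutral.
THEOREMS ONLY (0 `def`, 0 `instance`, 0 `sorry`).  HONESTY GUARD (director-ym №338 (5)): PURELY ADDITIVE — the parent stays landed and true on its own text; nothing in it is edited; no displayed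
premise of any consumer is deleted or weakened; every hypothesis stays a hypothesis.  Nothing of Bałaban's analysis asserted; N12 NOT discharged; K0⁷ ∕ K1⁹ NOT closed; one finite 𝕋⁴ programme
at fixed ε — nothing continuum ∕ ℝ⁴ ∕ OS; the Yang–Mills mass gap (Clay) is NOT proved by any of this.

PARENT's DOCSTRING (mathematics and citations; read `𝐁` as the bond datum `𝔅`; title as above):
Honest framing: statement-level skeleton of published theorems with citation tags; proofs where landed; nothing here is a claim about the
Yang–Mills mass gap.  Cell `pub-ymgap`, HUMAN RULING D-0062 ∕ D-0149, seat `pub-ymgap-dag-n12-c` (g20; N12 = [B15], strategy s1, lane owner); count-neutral helper of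
K1⁹ `stmt-QuantumFields-27364`; N12 NOT discharged; finite 𝕋⁴ at fixed ε; nothing continuum ∕ OS ∕ mass-gap ∕ Clay.

WHY (the lane's LOCATED-GEOM v3 memo, option (b) step (C1′)).  J-C v1.2 (`B15Prop1EndpointNearFlatLetters.h17Clause_of_nearFlatLetters_sub_loc`, p618172) and the coercivity step
`B15Prop1CoerciveAtNormalisedDatum.sliceCoercive_of_nearFlatLetters_sub_loc` (p623795) ask the (2.12) minimiser `U₀` to be bond-wise `δ`-near `1` on EVERY plaquette having a bond that
starts in `Ω₁(Z)`.  On a component of `Ω₁(Z)` carrying a non-contractible loop with large holonomy of the datum this is not inhabitable by any gauge (`B15Prop1HolonomyObstruction`,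
p637918).  [LF-II] p. 357 foot – p. 358 (1.7) reads the flat `∂*∂`-form and the bound (1.67) [10] on the WINDOW `B^k(Λ₀)` only; off the window the second variation of the Wilson action
needs only a ONE-SIDED bound, which holds at any background whose PLAQUETTE variables are `ε`-near `1` ([Balaban1985BackgroundPropagators] (3.8) «|U(∂p) − 1| < ε») — a gauge-invariant
letter, the currency of [15] Thm 1 (8).  Dag-n12-w4 typed that Wilson-side re-cut: `Node00.WilsonActionSecondVariationPlaqSmall{,Lattice}` (the per-plaquette ∕ lattice one-sided bounds)
and `B16Ineq17NearFlatWilsonLettersWindow.hessian_wilsonAction4_criticalExpChartFamily_ge_flatMin_sub_window` (the skeleton with the window flat form `B_W`).  THIS MODULE is the lane's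
junction at the endpoint's own objects: the `h17` clause and (1.9) at the slice of ONE base field with `hU` ↦ (`hUwin` on a displayed finite window `W` of plaquettes, `hPfar` plaquette
smallness on the plaquettes meeting `{b | b.src ∈ Ω₁(Z)}` off `W`), the Federbush fibre letter `hm` read against `B_W`, and the assembled constant
`Cerr = (32(d−1)δ + 8(d−1)ε + μ + 16(d−1)ρδ₂(2+ρδ₂))·Kc² + τ`.  Everything else VERBATIM from the `_sub_loc` editions; no family letter ∕ endpoint is re-keyed here (the socket editions
wait for the planner's ruling on the memo's options).

CONTENTS (theorems only; no `def`, no `instance`, no `sorry`).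
* §1 ★★ `h17Clause_of_nearFlatLetters_sub_window` — one instance, one base field: the window package ⇒ the `h17` clause for every slice vector `X`.
* §2 ★★ `sliceCoercive_of_nearFlatLetters_sub_window` — the same package + numerics `hsm`∕`hγle` ⇒ (1.9) `γ∕M⁵·‖X‖² ≤ ⟪X, D(∇ sliceFn …)(0) X⟫` at the slice.
* §3 ★★ `hessian_wilsonAction4_criticalExpChartFamily_ge_direct_sub_window` (generic torus ∕ level ∕ `N`), ★★ `h17Clause_of_windowLetters_direct`, ★★ `sliceCoercive_of_windowLetters_direct`
  — the DIRECT editions: the Federbush letter asked AT THE VELOCITY `X_f′X` (`γ₀·circ X − τ‖X‖² ≤ B_W(X_f′X, X_f′X)`); the flat linearisation `L♭`, its right inverse `R♭`, the size `q`,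
  the constants `ρ`, `δ₂` and the row (δ₂) DISAPPEAR from the socket (they only served to move `X_f′X` into `L♭`'s fibre); constant `(32(d−1)δ + 8(d−1)ε + μ)·Kc² + τ`.
* §4 ★★★ `hcoer_of_windowLettersDirect_gaugeNormalisable` — the FAMILY letter of the direct road (p627443 §5's general-region shape with the package (N) replaced by the window∕direct
  package (WD)): the socket text a producer of the direct road inhabits; conclusion = the `_ofCoercive` chain's `hcoer` verbatim.
* §5 (v1.1) ★★★ `hcoer_of_windowLettersDirect_normalised_box` — the same in p623795 §3's BOX-NORMALISER shape (region parallelepipeds `[LO i, HI i]`, dag-n12-w6's normaliser inside):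
  the binder list dag-n12-w5's (ii) `B15Prop1EndpointFromLetterFamiliesLoc` §2 call reads, with `hNFn` ↦ `hWD`.
HONEST SCOPE: composition by name of landed theorems (dag-n12-w4's window skeleton, this lane's p604041 ∕ p618172 ∕ p623795 steps, dag-n12-w5's support letter); every letter stays
DISPLAYED; the window `W`, `ε` and the `B_W`-Federbush producer are the consumer's; nothing of Bałaban's is asserted.
-/


noncomputable section

open Set Finset Metric Filter
open scoped BigOperators Matrix RealInnerProductSpace Real InnerProductSpace Topology

namespace Literature.MathematicalPhysics.QuantumFieldTheory.Balaban1983to89.B15Prop1EndpointNearFlatLettersWindowB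

open B15Prop1EndpointNearFlatLettersWindow
open B15Prop1EndpointNearFlatLettersWindow (hessian_wilsonAction4_criticalExpChartFamily_ge_direct_sub_window)

open B15DeterminingSetsB

open B15DeterminingSets GaugeField B16Sect1Backgrounds B15Prop1Carrier B8Eq17ClassAkV1 BlockAveraging
open B15Prop1SliceTaylorCalculus B15Prop1OneSidedIneq17OfFun
open B15Prop1SliceHessianOfChartFamily (eventually_sliceFn_fun177stdB_bgMSCoPOfRecordB_eq_wilsonAction4 h17Shape_of_hessian_chartFamily_ge_sub)
open B16Ineq17NearFlatDatumFamily (haff_msChartB_of_isMinimizerB_family)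
open B16Ineq19FlatSliceChart (exists_lieSU2Coord)
open B15Prop1CoerciveAtNormalisedDatum (hessian_coercive_of_h17_ofDec)
open B16Ineq17NearFlatWilsonLettersWindow (hessian_wilsonAction4_criticalExpChartFamily_ge_flatMin_sub_window)
open B15Prop1ChartCalculusSU2 (E3)
open T4CubeChartGnomonic (SU2)
open B15Prop1ChartSU2 (su2Chart)
open B15Prop1SliceCoordinates (GaugeSlice ιA freeBonds)
open T4AdjointCovarianceUnitary (lieSU)
open T4AxialGaugeSmallField (castSite boxPlaqs boxBonds)
open B6BondElimination (unitVec)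
open B6TreeGaugePoincare (curl)
open B16Eq18Proof (box mem_box)
open B15Extension193 (extend)
open B15ShellGauge193 (shellGauge)
open B14.Eq213DetSet B14.Eq216Concrete B15Sect1Instances B15Eq177GaugeInvariance B15Eq177ValueInvariance B15Eq177ValueInvarianceCoDiv B16Sect1Wilson
open B14.Eq22Determines (blockIter IsBlockUnion)
open Literature.MathematicalPhysics.QuantumFieldTheory.BalabanImbrieJaffe1984to88.BIJ85Eq453GaugeField
open Node00 (expChart msChartB constrCardB SU)
open T4Continuum
open scoped Matrix.Norms.L2Operator



section

/-- `ContDiffAt ℝ 2 X 0` ⇒ `X` has a derivative at `0`, `D X` has a derivative at `0`, and `X` is differentiable near `0` (private plumbing for the skeleton's binders). [folklore] -/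
private theorem triple_of_contDiffAt_two {G E : Type*} [NormedAddCommGroup G] [NormedSpace ℝ G] [NormedAddCommGroup E] [NormedSpace ℝ E]
    {X : G → E} (h : ContDiffAt ℝ 2 X 0) :
    HasFDerivAt X (fderiv ℝ X 0) 0 ∧ HasFDerivAt (fun g => fderiv ℝ X g) (fderiv ℝ (fun g => fderiv ℝ X g) 0) 0 ∧
      ∀ᶠ g in 𝓝 (0 : G), DifferentiableAt ℝ X g := by
  refine ⟨(h.differentiableAt (by norm_num)).hasFDerivAt, ?_, ?_⟩
  · have h1 : ContDiffAt ℝ 1 (fun g => fderiv ℝ X g) 0 := h.fderiv_right (m := 1) (by norm_num)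
    exact (h1.differentiableAt (by norm_num)).hasFDerivAt
  · obtain ⟨f', u, hu, -, huf⟩ := contDiffAt_one_iff.1 (h.of_le (by norm_num))
    filter_upwards [hu] with g hg using (huf g hg).differentiableAt

end

section
variable {F : T4Family}

/-- ★★ **THE `h17` CLAUSE — WINDOW + DIRECT EDITION**: as §1's `h17Clause_of_nearFlatLetters_sub_window` but with the per-vector chart letters REDUCED to (μ), (K) and the Federbush
letter AT THE VELOCITY `γ₀·circ X − τ·‖X‖² ≤ B_W(X_f′X, X_f′X)`; the binders `q`, `L♭`, `R♭`, `hRf`, `hρ`, `ρ`, `δ₂` and the row (δ₂) are GONE, and the constant is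
`(32(d−1)δ + 8(d−1)ε + μ)·Kc² + τ`.  Proof: §3's direct skeleton in place of the fibre-transfer one; everything else verbatim.
[cite: Balaban1989LargeFieldII, p.357, (1.7)–(1.9) p.358, (1.12)–(1.13) p.359; Balaban1985BackgroundPropagators, (3.8) p.391, (3.10) p.392; Balaban1989LargeFieldI, (1.74) p.192, (1.77) and Prop. 1 p.194; Balaban1988Convergent, (2.2) p.255, (2.12)–(2.13) pp.256–257; Balaban1985Variational, Thm 1 (8) p.279, (47) p.285, (81) p.290, Prop. 9 (190) p.309] -/
theorem h17Clause_of_windowLetters_direct (ν : Node00.Stage7Numerics) (Kt : ℕ) {k : ℕ} (hk : k ≤ (F.P Kt).m + (F.P Kt).K)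
    (bd : ℕ → (ℕ → Set (Site (F.P Kt) 0)) → BDetSet (F.P Kt)) (Z Λ : Set (Site (F.P Kt) 0)) (T : Finset (PBond (F.P Kt) k))
    (ext : GaugeField (F.P Kt) k SU2 → GaugeField (F.P Kt) k SU2) (Vk : GaugeField (F.P Kt) k SU2)
    (S : Set (PBond (F.P Kt) 0)) (hS : ∀ b ∉ S, b ∈ bd k (maxDomT ν.M₁ Z) 0)
    (hfar : ∀ b ∉ S, (⟨blockIter k b.src, b.dir⟩ : PBond (F.P Kt) k) ∉ bondsOf (pts k Λ))
    (circ : GaugeSlice (pts k Λ) T E3 → ℝ) {γ₀ δ ε μ Kc τ : ℝ} (hδ0 : 0 ≤ δ) (hε0 : 0 ≤ ε) (hμ0 : 0 ≤ μ)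
    (U₀ : GaugeField (F.P Kt) 0 SU2) (W : Finset (Plaq (F.P Kt) 0))
    (hUwin : ∀ p ∈ W, ‖((U₀ ⟨p.src, p.μ⟩ : SU2) : Matrix (Fin 2) (Fin 2) ℂ) - 1‖ ≤ δ ∧ ‖((U₀ ⟨p.src.shift p.μ, p.ν⟩ : SU2) : Matrix (Fin 2) (Fin 2) ℂ) - 1‖ ≤ δ ∧
        ‖((U₀ ⟨p.src.shift p.ν, p.μ⟩ : SU2) : Matrix (Fin 2) (Fin 2) ℂ) - 1‖ ≤ δ ∧ ‖((U₀ ⟨p.src, p.ν⟩ : SU2) : Matrix (Fin 2) (Fin 2) ℂ) - 1‖ ≤ δ)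
    (hPfar : ∀ p ∉ W, ((⟨p.src, p.μ⟩ : PBond (F.P Kt) 0) ∈ S ∨
        (⟨p.src.shift p.μ, p.ν⟩ : PBond (F.P Kt) 0) ∈ S ∨
        (⟨p.src.shift p.ν, p.μ⟩ : PBond (F.P Kt) 0) ∈ S ∨
        (⟨p.src, p.ν⟩ : PBond (F.P Kt) 0) ∈ S) →
      ‖((GaugeField.plaqHol U₀ p : SU2) : Matrix (Fin 2) (Fin 2) ℂ) - 1‖ ≤ ε)
    (Xf : GaugeSlice (pts k Λ) T E3 → PBond (F.P Kt) 0 → lieSU (Fin 2)) (hX₀ : Xf 0 = 0) (hXc : ContDiffAt ℝ 2 Xf 0)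
    (hmin : ∀ᶠ Y in 𝓝 (0 : GaugeSlice (pts k Λ) T E3),
      IsMinimizerB (Node00.avOfRecord F 2 Kt) (Node00.regMSCoPOfRecord F 2 ν Kt k (maxDomT ν.M₁ Z)) (bd k (maxDomT ν.M₁ Z))
        (avgFamily (Node00.avOfRecord F 2 Kt) (qsstarGIter0 k (expMul su2Chart (ιA (pts k Λ) T Y) (ext Vk)))) (expChart U₀ (Xf Y)))
    {Ψ₂ : (PBond (F.P Kt) 0 → lieSU (Fin 2)) →L[ℝ] (PBond (F.P Kt) 0 → lieSU (Fin 2)) →L[ℝ] (Fin (constrCardB (bd k (maxDomT ν.M₁ Z)) k) → lieSU (Fin 2))}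
    (hΨ₂ : HasFDerivAt (fun Y => fderiv ℝ (msChartB F 2 Kt k (bd k (maxDomT ν.M₁ Z)) (avgFamily (Node00.avOfRecord F 2 Kt) (qsstarGIter0 k (ext Vk))) U₀) Y) Ψ₂ 0)
    (hΨd : ∀ᶠ Y in 𝓝 (0 : PBond (F.P Kt) 0 → lieSU (Fin 2)), DifferentiableAt ℝ (msChartB F 2 Kt k (bd k (maxDomT ν.M₁ Z)) (avgFamily (Node00.avOfRecord F 2 Kt) (qsstarGIter0 k (ext Vk))) U₀) Y)
    {lam : (Fin (constrCardB (bd k (maxDomT ν.M₁ Z)) k) → lieSU (Fin 2)) →L[ℝ] ℝ}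
    (hlam : fderiv ℝ (fun Y : PBond (F.P Kt) 0 → lieSU (Fin 2) => wilsonAction4 (expChart U₀ Y)) 0 =
      lam.comp (fderiv ℝ (msChartB F 2 Kt k (bd k (maxDomT ν.M₁ Z)) (avgFamily (Node00.avOfRecord F 2 Kt) (qsstarGIter0 k (ext Vk))) U₀) 0))
    (p : Seminorm ℝ (PBond (F.P Kt) 0 → lieSU (Fin 2))) (hp : ∀ Y : PBond (F.P Kt) 0 → lieSU (Fin 2), ∑ b, ‖(Y b : Matrix (Fin 2) (Fin 2) ℂ)‖ ^ 2 ≤ p Y ^ 2)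
    -- per slice vector: (μ), (K) and the Federbush letter AT THE VELOCITY against the window form
    (hX : ∀ X : GaugeSlice (pts k Λ) T E3,
      lam (Ψ₂ (fderiv ℝ Xf 0 X) (fderiv ℝ Xf 0 X)) ≤ μ * p (fderiv ℝ Xf 0 X) ^ 2 ∧
      p (fderiv ℝ Xf 0 X) ≤ Kc * ‖X‖ ∧
      γ₀ * circ X - τ * ‖X‖ ^ 2 ≤ ((Fintype.card (Fin 2) : ℝ)⁻¹ • ∑ p ∈ W, (innerSL ℝ (E := lieSU (Fin 2))).bilinearComp
            (ContinuousLinearMap.proj (R := ℝ) (φ := fun _ : PBond (F.P Kt) 0 => lieSU (Fin 2)) (⟨p.src, p.μ⟩ : PBond (F.P Kt) 0) + ContinuousLinearMap.proj (R := ℝ) (φ := fun _ : PBond (F.P Kt) 0 => lieSU (Fin 2)) (⟨p.src.shift p.μ, p.ν⟩ : PBond (F.P Kt) 0)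
              - ContinuousLinearMap.proj (R := ℝ) (φ := fun _ : PBond (F.P Kt) 0 => lieSU (Fin 2)) (⟨p.src.shift p.ν, p.μ⟩ : PBond (F.P Kt) 0) - ContinuousLinearMap.proj (R := ℝ) (φ := fun _ : PBond (F.P Kt) 0 => lieSU (Fin 2)) (⟨p.src, p.ν⟩ : PBond (F.P Kt) 0))
            (ContinuousLinearMap.proj (R := ℝ) (φ := fun _ : PBond (F.P Kt) 0 => lieSU (Fin 2)) (⟨p.src, p.μ⟩ : PBond (F.P Kt) 0) + ContinuousLinearMap.proj (R := ℝ) (φ := fun _ : PBond (F.P Kt) 0 => lieSU (Fin 2)) (⟨p.src.shift p.μ, p.ν⟩ : PBond (F.P Kt) 0)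
              - ContinuousLinearMap.proj (R := ℝ) (φ := fun _ : PBond (F.P Kt) 0 => lieSU (Fin 2)) (⟨p.src.shift p.ν, p.μ⟩ : PBond (F.P Kt) 0) - ContinuousLinearMap.proj (R := ℝ) (φ := fun _ : PBond (F.P Kt) 0 => lieSU (Fin 2)) (⟨p.src, p.ν⟩ : PBond (F.P Kt) 0))
            : (PBond (F.P Kt) 0 → lieSU (Fin 2)) →L[ℝ] (PBond (F.P Kt) 0 → lieSU (Fin 2)) →L[ℝ] ℝ) (fderiv ℝ Xf 0 X) (fderiv ℝ Xf 0 X))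
    (X : GaugeSlice (pts k Λ) T E3) :
    γ₀ * circ X - ((32 * (((F.P Kt).d : ℝ) - 1) * δ + 8 * (((F.P Kt).d : ℝ) - 1) * ε + μ) * Kc ^ 2 + τ) * ‖X‖ ^ 2
      ≤ ⟪X, fderiv ℝ (rGrad (pts k Λ) T (sliceFn (pts k Λ) T (fun177stdB (Node00.bgMSCoPOfRecordB F 2 ν Kt k (maxDomT ν.M₁ Z)) ν.M₁ bd Z k) (ext Vk))) 0 X⟫_ℝ := by
  obtain ⟨hX1, hX2, hXd⟩ := triple_of_contDiffAt_two hXc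
  obtain ⟨hμ, hK, hmX⟩ := hX X
  obtain ⟨φ, hφ⟩ := exists_lieSU2Coord
  have haff := haff_msChartB_of_isMinimizerB_family (pts k Λ) T hk hφ (bd k (maxDomT ν.M₁ Z)) (Node00.regMSCoPOfRecord F 2 ν Kt k (maxDomT ν.M₁ Z)) (ext Vk) U₀ hmin lam X X
  have hval := eventually_sliceFn_fun177stdB_bgMSCoPOfRecordB_eq_wilsonAction4 ν Kt k (maxDomT ν.M₁ Z) ν.M₁ bd Z (pts k Λ) T (ext Vk) hmin
  have hsupp : ∀ b ∉ S, fderiv ℝ Xf 0 X b = 0 := fun b hb =>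
    (B15Prop1RealChartFamilySupportB.support_realChartFamily_atRecord ν Kt hk (bd k (maxDomT ν.M₁ Z)) Z Λ T ext Vk S hS hfar U₀ Xf hX₀ hXc.continuousAt hmin).2 X b hb
  have hd : 0 ≤ ((F.P Kt).d : ℝ) - 1 := by
    have h1 : (1 : ℝ) ≤ (F.P Kt).d := by exact_mod_cast (F.P Kt).hd
    linarith
  have hC : 0 ≤ 32 * (((F.P Kt).d : ℝ) - 1) * δ + 8 * (((F.P Kt).d : ℝ) - 1) * ε + μ := by positivity
  have hlow := hessian_wilsonAction4_criticalExpChartFamily_ge_direct_sub_window (N := 2) U₀ W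
    S hδ0 hε0 hUwin hPfar (X := Xf) (g₀ := (0 : GaugeSlice (pts k Λ) T E3))
    hX₀ hX1 hX2 hXd hΨ₂ hΨd hlam X hsupp haff p hp hμ (le_refl _)
  exact h17Shape_of_hessian_chartFamily_ge_sub (pts k Λ) T
    (fun177stdB (Node00.bgMSCoPOfRecordB F 2 ν Kt k (maxDomT ν.M₁ Z)) ν.M₁ bd Z k) (ext Vk) U₀ hX1 hX2 hXd hval X p hC hlow hmX hK

end

section
variable {F : T4Family}

/-- ★★ **(1.9) AT THE SLICE — WINDOW + DIRECT EDITION**: as §2's `sliceCoercive_of_nearFlatLetters_sub_window` with the per-vector letters reduced to (μ), (K) and the Federbush letter at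
the velocity (the endpoint's curl sum as `circ`), numerics `hsm : (32(d−1)δ + 8(d−1)ε + μ)·Kc² + τ ≤ γ₀∕(2(3K²+2K⁴))`, `hγle`.
[cite: Balaban1989LargeFieldII, p.357, (1.7)–(1.9) p.358, (1.12)–(1.13) p.359; Balaban1985BackgroundPropagators, (3.8) p.391, (3.10) p.392; Balaban1989LargeFieldI, (1.74) p.192, (1.77) and Prop. 1 p.194; Balaban1985Variational, (47) p.285, (81) p.290, Prop. 9 (190) p.309; Balaban1988Convergent, (2.2) p.255, (2.12)–(2.13) pp.256–257] -/
theorem sliceCoercive_of_windowLetters_direct (ν : Node00.Stage7Numerics) (Kt : ℕ) (hd3 : 3 ≤ (F.P Kt).d) (h0 : 0 < (F.P Kt).d)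
    {k : ℕ} (hk : k ≤ (F.P Kt).m + (F.P Kt).K)
    (bd : ℕ → (ℕ → Set (Site (F.P Kt) 0)) → BDetSet (F.P Kt)) (Z Λ : Set (Site (F.P Kt) 0)) (T : Finset (PBond (F.P Kt) k))
    {lo hi : Fin (F.P Kt).d → ℤ} (hbox : pts k Λ = (castSite '' Set.Icc lo hi : Set (Site (F.P Kt) k)))
    (hTG0 : T = (box (fun κ => (hi κ - lo κ + 1).toNat) lo).image fun x => (⟨castSite (x - unitVec ⟨0, h0⟩), ⟨0, h0⟩⟩ : PBond (F.P Kt) k))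
    (hN5 : ∀ κ, ((hi κ - lo κ + 1).toNat : ℤ) + 5 < (F.P Kt).sitesPerDir k) {K : ℕ} (hK1 : 1 ≤ K) (hKn : ∀ κ, (hi κ - lo κ + 1).toNat ≤ K)
    (ext : GaugeField (F.P Kt) k SU2 → GaugeField (F.P Kt) k SU2) (Vk : GaugeField (F.P Kt) k SU2)
    (S : Set (PBond (F.P Kt) 0)) (hS : ∀ b ∉ S, b ∈ bd k (maxDomT ν.M₁ Z) 0)
    (hfar : ∀ b ∉ S, (⟨blockIter k b.src, b.dir⟩ : PBond (F.P Kt) k) ∉ bondsOf (pts k Λ))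
    {γ M γ₀ δ ε μ Kc τ : ℝ} (hγ₀ : 0 ≤ γ₀) (hδ0 : 0 ≤ δ) (hε0 : 0 ≤ ε) (hμ0 : 0 ≤ μ)
    (U₀ : GaugeField (F.P Kt) 0 SU2) (W : Finset (Plaq (F.P Kt) 0))
    (hUwin : ∀ p ∈ W, ‖((U₀ ⟨p.src, p.μ⟩ : SU2) : Matrix (Fin 2) (Fin 2) ℂ) - 1‖ ≤ δ ∧ ‖((U₀ ⟨p.src.shift p.μ, p.ν⟩ : SU2) : Matrix (Fin 2) (Fin 2) ℂ) - 1‖ ≤ δ ∧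
        ‖((U₀ ⟨p.src.shift p.ν, p.μ⟩ : SU2) : Matrix (Fin 2) (Fin 2) ℂ) - 1‖ ≤ δ ∧ ‖((U₀ ⟨p.src, p.ν⟩ : SU2) : Matrix (Fin 2) (Fin 2) ℂ) - 1‖ ≤ δ)
    (hPfar : ∀ p ∉ W, ((⟨p.src, p.μ⟩ : PBond (F.P Kt) 0) ∈ S ∨
        (⟨p.src.shift p.μ, p.ν⟩ : PBond (F.P Kt) 0) ∈ S ∨
        (⟨p.src.shift p.ν, p.μ⟩ : PBond (F.P Kt) 0) ∈ S ∨
        (⟨p.src, p.ν⟩ : PBond (F.P Kt) 0) ∈ S) →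
      ‖((GaugeField.plaqHol U₀ p : SU2) : Matrix (Fin 2) (Fin 2) ℂ) - 1‖ ≤ ε)
    (Xf : GaugeSlice (pts k Λ) T E3 → PBond (F.P Kt) 0 → lieSU (Fin 2)) (hX₀ : Xf 0 = 0) (hXc : ContDiffAt ℝ 2 Xf 0)
    (hmin : ∀ᶠ Y in 𝓝 (0 : GaugeSlice (pts k Λ) T E3),
      IsMinimizerB (Node00.avOfRecord F 2 Kt) (Node00.regMSCoPOfRecord F 2 ν Kt k (maxDomT ν.M₁ Z)) (bd k (maxDomT ν.M₁ Z))
        (avgFamily (Node00.avOfRecord F 2 Kt) (qsstarGIter0 k (expMul su2Chart (ιA (pts k Λ) T Y) (ext Vk)))) (expChart U₀ (Xf Y)))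
    {Ψ₂ : (PBond (F.P Kt) 0 → lieSU (Fin 2)) →L[ℝ] (PBond (F.P Kt) 0 → lieSU (Fin 2)) →L[ℝ] (Fin (constrCardB (bd k (maxDomT ν.M₁ Z)) k) → lieSU (Fin 2))}
    (hΨ₂ : HasFDerivAt (fun Y => fderiv ℝ (msChartB F 2 Kt k (bd k (maxDomT ν.M₁ Z)) (avgFamily (Node00.avOfRecord F 2 Kt) (qsstarGIter0 k (ext Vk))) U₀) Y) Ψ₂ 0)
    (hΨd : ∀ᶠ Y in 𝓝 (0 : PBond (F.P Kt) 0 → lieSU (Fin 2)), DifferentiableAt ℝ (msChartB F 2 Kt k (bd k (maxDomT ν.M₁ Z)) (avgFamily (Node00.avOfRecord F 2 Kt) (qsstarGIter0 k (ext Vk))) U₀) Y)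
    {lam : (Fin (constrCardB (bd k (maxDomT ν.M₁ Z)) k) → lieSU (Fin 2)) →L[ℝ] ℝ}
    (hlam : fderiv ℝ (fun Y : PBond (F.P Kt) 0 → lieSU (Fin 2) => wilsonAction4 (expChart U₀ Y)) 0 =
      lam.comp (fderiv ℝ (msChartB F 2 Kt k (bd k (maxDomT ν.M₁ Z)) (avgFamily (Node00.avOfRecord F 2 Kt) (qsstarGIter0 k (ext Vk))) U₀) 0))
    (p : Seminorm ℝ (PBond (F.P Kt) 0 → lieSU (Fin 2))) (hp : ∀ Y : PBond (F.P Kt) 0 → lieSU (Fin 2), ∑ b, ‖(Y b : Matrix (Fin 2) (Fin 2) ℂ)‖ ^ 2 ≤ p Y ^ 2)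
    (hX : ∀ X : GaugeSlice (pts k Λ) T E3,
      lam (Ψ₂ (fderiv ℝ Xf 0 X) (fderiv ℝ Xf 0 X)) ≤ μ * p (fderiv ℝ Xf 0 X) ^ 2 ∧
      p (fderiv ℝ Xf 0 X) ≤ Kc * ‖X‖ ∧
      γ₀ * (∑ z ∈ box (fun κ => (hi κ - lo κ + 1).toNat + 3) (fun κ => lo κ - 2), ∑ μ : Fin (F.P Kt).d, ∑ a : Fin 3,
            curl (fun b => ιA (pts k Λ) T X (⟨castSite b.1, b.2⟩ : PBond (F.P Kt) k) a) z ⟨0, h0⟩ μ ^ 2) - τ * ‖X‖ ^ 2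
        ≤ ((Fintype.card (Fin 2) : ℝ)⁻¹ • ∑ p ∈ W, (innerSL ℝ (E := lieSU (Fin 2))).bilinearComp
            (ContinuousLinearMap.proj (R := ℝ) (φ := fun _ : PBond (F.P Kt) 0 => lieSU (Fin 2)) (⟨p.src, p.μ⟩ : PBond (F.P Kt) 0) + ContinuousLinearMap.proj (R := ℝ) (φ := fun _ : PBond (F.P Kt) 0 => lieSU (Fin 2)) (⟨p.src.shift p.μ, p.ν⟩ : PBond (F.P Kt) 0)
              - ContinuousLinearMap.proj (R := ℝ) (φ := fun _ : PBond (F.P Kt) 0 => lieSU (Fin 2)) (⟨p.src.shift p.ν, p.μ⟩ : PBond (F.P Kt) 0) - ContinuousLinearMap.proj (R := ℝ) (φ := fun _ : PBond (F.P Kt) 0 => lieSU (Fin 2)) (⟨p.src, p.ν⟩ : PBond (F.P Kt) 0))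
            (ContinuousLinearMap.proj (R := ℝ) (φ := fun _ : PBond (F.P Kt) 0 => lieSU (Fin 2)) (⟨p.src, p.μ⟩ : PBond (F.P Kt) 0) + ContinuousLinearMap.proj (R := ℝ) (φ := fun _ : PBond (F.P Kt) 0 => lieSU (Fin 2)) (⟨p.src.shift p.μ, p.ν⟩ : PBond (F.P Kt) 0)
              - ContinuousLinearMap.proj (R := ℝ) (φ := fun _ : PBond (F.P Kt) 0 => lieSU (Fin 2)) (⟨p.src.shift p.ν, p.μ⟩ : PBond (F.P Kt) 0) - ContinuousLinearMap.proj (R := ℝ) (φ := fun _ : PBond (F.P Kt) 0 => lieSU (Fin 2)) (⟨p.src, p.ν⟩ : PBond (F.P Kt) 0))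
            : (PBond (F.P Kt) 0 → lieSU (Fin 2)) →L[ℝ] (PBond (F.P Kt) 0 → lieSU (Fin 2)) →L[ℝ] ℝ) (fderiv ℝ Xf 0 X) (fderiv ℝ Xf 0 X))
    (hsm : (32 * (((F.P Kt).d : ℝ) - 1) * δ + 8 * (((F.P Kt).d : ℝ) - 1) * ε + μ) * Kc ^ 2 + τ ≤ γ₀ / (2 * (3 * (K : ℝ) ^ 2 + 2 * (K : ℝ) ^ 4)))
    (hγle : γ / M ^ 5 ≤ γ₀ / (2 * (3 * (K : ℝ) ^ 2 + 2 * (K : ℝ) ^ 4)))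
    (X : GaugeSlice (pts k Λ) T E3) :
    γ / M ^ 5 * ‖X‖ ^ 2
      ≤ ⟪X, fderiv ℝ (rGrad (pts k Λ) T (sliceFn (pts k Λ) T (fun177stdB (Node00.bgMSCoPOfRecordB F 2 ν Kt k (maxDomT ν.M₁ Z)) ν.M₁ bd Z k) (ext Vk))) 0 X⟫_ℝ :=
  hessian_coercive_of_h17_ofDec (hdec := inferInstance) (Subsingleton.elim _ _) hd3 h0 hbox hTG0 hN5 hK1 hKn hγ₀
    (sliceFn (pts k Λ) T (fun177stdB (Node00.bgMSCoPOfRecordB F 2 ν Kt k (maxDomT ν.M₁ Z)) ν.M₁ bd Z k) (ext Vk))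
    (fun X => h17Clause_of_windowLetters_direct ν Kt hk bd Z Λ T ext Vk S hS hfar
      (fun X => ∑ z ∈ box (fun κ => (hi κ - lo κ + 1).toNat + 3) (fun κ => lo κ - 2), ∑ μ : Fin (F.P Kt).d, ∑ a : Fin 3,
        curl (fun b => ιA (pts k Λ) T X (⟨castSite b.1, b.2⟩ : PBond (F.P Kt) k) a) z ⟨0, h0⟩ μ ^ 2)
      hδ0 hε0 hμ0 U₀ W hUwin hPfar Xf hX₀ hXc hmin hΨ₂ hΨd hlam p hp hX X)
    hsm hγle X

end

section
variable {F : T4Family}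

/-- ★★★ **THE (1.9) FAMILY LETTER `hcoer` FROM THE WINDOW∕DIRECT PACKAGE — BOX-NORMALISER EDITION.**  As this lane's
`B15Prop1CoerciveAtNormalisedDatum.hcoer_of_nearFlatLettersNormalised_sub_loc` (p623795 §3: per instance a REGION parallelepiped `[LO i, HI i] ⊇ [lo i − 1, hi i + 1]` of at most
`n′ i + 1` sites per direction, non-wrapping, plaquettes in `Z_i^{(k)}`, datum tolerance `ρn i ≥ (d·n′ i + 1)·((d − 1)n′ i·(12d(n i + 2)² + 1) + 3d(n i + 2)²)·eR i`; the package asked only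
at guarded base fields whose extended datum is `ρn i`-near `1` on the region box — dag-n12-w6's box normaliser discharges the gauge inside), with the package (N) REPLACED by the
window∕direct package (WD) of §4 (C1_window `δc i` on a finite window `W`, P1 `εc i` off it, (μ), (K), Federbush letter at the velocity against `B_W`; no `L♭ ∕ R♭ ∕ q ∕ ρ ∕ δ₂`);
numerics `hsm : (32(d−1)δc i + 8(d−1)εc i + μc i)·(Kc i)² + τc i ≤ γ₀∕(2(3K_i²+2K_i⁴))`, `hγle`.  Conclusion: the `_ofCoercive` chain's `hcoer` verbatim — the binder list of
dag-n12-w5's `B15Prop1EndpointFromLetterFamiliesLoc` §2 call with `hNFn` ↦ `hWD`.  Proof: p623795 §2 `sliceCoercive_fun177std_bgMSCoPOfRecord_of_normalised` with `hnorm` from §3's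
`sliceCoercive_of_windowLetters_direct`.
[cite: Balaban1989LargeFieldI, (1.74) p.192, p.193, (1.77) and the sentence after it, Prop. 1 p.194; Balaban1989LargeFieldII, p.357, (1.7)–(1.9) p.358, (1.12)–(1.13) p.359; Balaban1985BackgroundPropagators, (3.8) p.391, (3.10) p.392; Balaban1985Variational, (47) p.285, (81) p.290, Prop. 9 (190) p.309; Balaban1988Convergent, (2.2) p.255, (2.12)–(2.13) pp.256–257] -/
theorem hcoer_of_windowLettersDirect_normalised_box
    (ν : Node00.Stage7Numerics) (Kt : ℕ) (hd3 : 3 ≤ (F.P Kt).d) (h0 : 0 < (F.P Kt).d) {ι : Type}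
    (bd : ℕ → (ℕ → Set (Site (F.P Kt) 0)) → BDetSet (F.P Kt))
    (Z Λ : ι → Set (Site (F.P Kt) 0)) (k : ι → ℕ) (M : ι → ℝ) (hk : ∀ i, k i ≤ (F.P Kt).m + (F.P Kt).K)
    (hbd : ∀ i j, (F.P Kt).m + (F.P Kt).K < j → bd (k i) (maxDomT ν.M₁ (Z i)) j = ∅)
    (S : ι → Set (PBond (F.P Kt) 0)) (hS : ∀ i, ∀ b ∉ S i, b ∈ bd (k i) (maxDomT ν.M₁ (Z i)) 0)
    (eR : ι → ℝ) (heR : ∀ i, 0 < eR i)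
    (T : ∀ i, Finset (PBond (F.P Kt) (k i)))
    (lo hi : ι → Fin (F.P Kt).d → ℤ) (n : ι → ℕ) (hn : ∀ i κ, hi i κ ≤ lo i κ + n i)
    (hbox : ∀ i, pts (k i) (Λ i) = (castSite '' Set.Icc (lo i) (hi i) : Set (Site (F.P Kt) (k i))))
    (hZ : ∀ i, (boxPlaqs (lo i - 1) (hi i + 1) : Set (Plaq (F.P Kt) (k i))) ⊆ plaqsInside (pts (k i) (Z i)))
    (hTG0 : ∀ i, T i = (box (fun κ => (hi i κ - lo i κ + 1).toNat) (lo i)).image fun x =>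
      (⟨castSite (x - unitVec ⟨0, h0⟩), ⟨0, h0⟩⟩ : PBond (F.P Kt) (k i)))
    (hN5 : ∀ i κ, ((hi i κ - lo i κ + 1).toNat : ℤ) + 5 < (F.P Kt).sitesPerDir (k i))
    (K : ι → ℕ) (hK1 : ∀ i, 1 ≤ K i) (hKn : ∀ i κ, (hi i κ - lo i κ + 1).toNat ≤ K i)
    (ext : ∀ i, GaugeField (F.P Kt) (k i) SU2 → GaugeField (F.P Kt) (k i) SU2)
    (hext : ∀ i Vk, ext i Vk = extend (pts (k i) (Λ i)) (shellGauge Vk (lo i) (hi i)) Vk)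
    (hlohi : ∀ i, lo i ≤ hi i)
    -- the REGION parallelepipeds of the normalisation and the datum tolerances
    (LO HI : ι → Fin (F.P Kt).d → ℤ) (hLO : ∀ i, LO i ≤ lo i - 1) (hHI : ∀ i, hi i + 1 ≤ HI i) (n' : ι → ℕ) (hn' : ∀ i κ, HI i κ ≤ LO i κ + n' i)
    (hn'N : ∀ i, n' i < (F.P Kt).sitesPerDir (k i)) (hR : ∀ i, (boxPlaqs (LO i) (HI i) : Set (Plaq (F.P Kt) (k i))) ⊆ plaqsInside (pts (k i) (Z i)))
    (ρn : ι → ℝ)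
    (hρn : ∀ i, (((F.P Kt).d : ℝ) * n' i + 1) * ((((F.P Kt).d - 1 : ℕ) : ℝ) * n' i * ((12 * (F.P Kt).d * (n i + 2) ^ 2 + 1) * eR i)
      + 3 * (F.P Kt).d * (n i + 2) ^ 2 * eR i) ≤ ρn i)
    {γ : ℝ} {γ₀ : ℝ} (hγ₀ : 0 ≤ γ₀)
    -- (WD) THE WINDOW∕DIRECT LETTER PACKAGE per instance, asked ONLY at the guarded base fields whose extended datum is `ρn i`-near `1` on the region box
    {δc εc μc Kc τc : ι → ℝ} (hδc0 : ∀ i, 0 ≤ δc i) (hεc0 : ∀ i, 0 ≤ εc i) (hμc0 : ∀ i, 0 ≤ μc i)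
    (hWD : ∀ i (Vk : GaugeField (F.P Kt) (k i) SU2), PlaqSmallOn (plaqsInside (pts (k i) (Z i ∩ (Λ i)ᶜ))) (eR i) Vk →
      (∀ b ∈ (boxBonds (LO i) (HI i) : Set (PBond (F.P Kt) (k i))), dist1 (ext i Vk b) ≤ ρn i) →
      ∃ (U₀ : GaugeField (F.P Kt) 0 SU2) (Xf : GaugeSlice (pts (k i) (Λ i)) (T i) E3 → PBond (F.P Kt) 0 → lieSU (Fin 2)) (W : Finset (Plaq (F.P Kt) 0)),
        -- C1_window
        (∀ p ∈ W, ‖((U₀ ⟨p.src, p.μ⟩ : SU2) : Matrix (Fin 2) (Fin 2) ℂ) - 1‖ ≤ δc i ∧ ‖((U₀ ⟨p.src.shift p.μ, p.ν⟩ : SU2) : Matrix (Fin 2) (Fin 2) ℂ) - 1‖ ≤ δc i ∧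
            ‖((U₀ ⟨p.src.shift p.ν, p.μ⟩ : SU2) : Matrix (Fin 2) (Fin 2) ℂ) - 1‖ ≤ δc i ∧ ‖((U₀ ⟨p.src, p.ν⟩ : SU2) : Matrix (Fin 2) (Fin 2) ℂ) - 1‖ ≤ δc i) ∧
        -- P1
        (∀ p ∉ W, ((⟨p.src, p.μ⟩ : PBond (F.P Kt) 0) ∈ S i ∨
            (⟨p.src.shift p.μ, p.ν⟩ : PBond (F.P Kt) 0) ∈ S i ∨
            (⟨p.src.shift p.ν, p.μ⟩ : PBond (F.P Kt) 0) ∈ S i ∨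
            (⟨p.src, p.ν⟩ : PBond (F.P Kt) 0) ∈ S i) →
          ‖((GaugeField.plaqHol U₀ p : SU2) : Matrix (Fin 2) (Fin 2) ℂ) - 1‖ ≤ εc i) ∧
        Xf 0 = 0 ∧ ContDiffAt ℝ 2 Xf 0 ∧
        (∀ᶠ Y in 𝓝 (0 : GaugeSlice (pts (k i) (Λ i)) (T i) E3),
          IsMinimizerB (Node00.avOfRecord F 2 Kt) (Node00.regMSCoPOfRecord F 2 ν Kt (k i) (maxDomT ν.M₁ (Z i))) (bd (k i) (maxDomT ν.M₁ (Z i)))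
            (avgFamily (Node00.avOfRecord F 2 Kt) (qsstarGIter0 (k i) (expMul su2Chart (ιA (pts (k i) (Λ i)) (T i) Y) (ext i Vk)))) (expChart U₀ (Xf Y))) ∧
        ∃ (Ψ₂ : (PBond (F.P Kt) 0 → lieSU (Fin 2)) →L[ℝ] (PBond (F.P Kt) 0 → lieSU (Fin 2)) →L[ℝ] (Fin (constrCardB (bd (k i) (maxDomT ν.M₁ (Z i))) (k i)) → lieSU (Fin 2)))
          (lam : (Fin (constrCardB (bd (k i) (maxDomT ν.M₁ (Z i))) (k i)) → lieSU (Fin 2)) →L[ℝ] ℝ)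
          (p : Seminorm ℝ (PBond (F.P Kt) 0 → lieSU (Fin 2))),
          HasFDerivAt (fun Y => fderiv ℝ (msChartB F 2 Kt (k i) (bd (k i) (maxDomT ν.M₁ (Z i))) (avgFamily (Node00.avOfRecord F 2 Kt) (qsstarGIter0 (k i) (ext i Vk))) U₀) Y) Ψ₂ 0 ∧
          (∀ᶠ Y in 𝓝 (0 : PBond (F.P Kt) 0 → lieSU (Fin 2)),
            DifferentiableAt ℝ (msChartB F 2 Kt (k i) (bd (k i) (maxDomT ν.M₁ (Z i))) (avgFamily (Node00.avOfRecord F 2 Kt) (qsstarGIter0 (k i) (ext i Vk))) U₀) Y) ∧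
          fderiv ℝ (fun Y : PBond (F.P Kt) 0 → lieSU (Fin 2) => wilsonAction4 (expChart U₀ Y)) 0 =
            lam.comp (fderiv ℝ (msChartB F 2 Kt (k i) (bd (k i) (maxDomT ν.M₁ (Z i))) (avgFamily (Node00.avOfRecord F 2 Kt) (qsstarGIter0 (k i) (ext i Vk))) U₀) 0) ∧
          (∀ Y : PBond (F.P Kt) 0 → lieSU (Fin 2), ∑ b, ‖(Y b : Matrix (Fin 2) (Fin 2) ℂ)‖ ^ 2 ≤ p Y ^ 2) ∧
          ∀ X : GaugeSlice (pts (k i) (Λ i)) (T i) E3,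
            lam (Ψ₂ (fderiv ℝ Xf 0 X) (fderiv ℝ Xf 0 X)) ≤ μc i * p (fderiv ℝ Xf 0 X) ^ 2 ∧
            p (fderiv ℝ Xf 0 X) ≤ Kc i * ‖X‖ ∧
            γ₀ * (∑ z ∈ box (fun κ => (hi i κ - lo i κ + 1).toNat + 3) (fun κ => lo i κ - 2), ∑ μ : Fin (F.P Kt).d, ∑ a : Fin 3,
                  curl (fun b => ιA (pts (k i) (Λ i)) (T i) X (⟨castSite b.1, b.2⟩ : PBond (F.P Kt) (k i)) a) z ⟨0, h0⟩ μ ^ 2) - τc i * ‖X‖ ^ 2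
              ≤ ((Fintype.card (Fin 2) : ℝ)⁻¹ • ∑ p ∈ W, (innerSL ℝ (E := lieSU (Fin 2))).bilinearComp
              (ContinuousLinearMap.proj (R := ℝ) (φ := fun _ : PBond (F.P Kt) 0 => lieSU (Fin 2)) (⟨p.src, p.μ⟩ : PBond (F.P Kt) 0) + ContinuousLinearMap.proj (R := ℝ) (φ := fun _ : PBond (F.P Kt) 0 => lieSU (Fin 2)) (⟨p.src.shift p.μ, p.ν⟩ : PBond (F.P Kt) 0)
                - ContinuousLinearMap.proj (R := ℝ) (φ := fun _ : PBond (F.P Kt) 0 => lieSU (Fin 2)) (⟨p.src.shift p.ν, p.μ⟩ : PBond (F.P Kt) 0) - ContinuousLinearMap.proj (R := ℝ) (φ := fun _ : PBond (F.P Kt) 0 => lieSU (Fin 2)) (⟨p.src, p.ν⟩ : PBond (F.P Kt) 0))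
              (ContinuousLinearMap.proj (R := ℝ) (φ := fun _ : PBond (F.P Kt) 0 => lieSU (Fin 2)) (⟨p.src, p.μ⟩ : PBond (F.P Kt) 0) + ContinuousLinearMap.proj (R := ℝ) (φ := fun _ : PBond (F.P Kt) 0 => lieSU (Fin 2)) (⟨p.src.shift p.μ, p.ν⟩ : PBond (F.P Kt) 0)
                - ContinuousLinearMap.proj (R := ℝ) (φ := fun _ : PBond (F.P Kt) 0 => lieSU (Fin 2)) (⟨p.src.shift p.ν, p.μ⟩ : PBond (F.P Kt) 0) - ContinuousLinearMap.proj (R := ℝ) (φ := fun _ : PBond (F.P Kt) 0 => lieSU (Fin 2)) (⟨p.src, p.ν⟩ : PBond (F.P Kt) 0))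
              : (PBond (F.P Kt) 0 → lieSU (Fin 2)) →L[ℝ] (PBond (F.P Kt) 0 → lieSU (Fin 2)) →L[ℝ] ℝ) (fderiv ℝ Xf 0 X) (fderiv ℝ Xf 0 X))
    -- numerics: the assembled DIRECT `Cerr i` is small, and the positivity constant fits
    (hsm : ∀ i, (32 * (((F.P Kt).d : ℝ) - 1) * δc i + 8 * (((F.P Kt).d : ℝ) - 1) * εc i + μc i) * Kc i ^ 2 + τc i
      ≤ γ₀ / (2 * (3 * (K i : ℝ) ^ 2 + 2 * (K i : ℝ) ^ 4)))
    (hγle : ∀ i, γ / (M i) ^ 5 ≤ γ₀ / (2 * (3 * (K i : ℝ) ^ 2 + 2 * (K i : ℝ) ^ 4)))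
    (hfar : ∀ i, ∀ b ∉ S i, (⟨blockIter (k i) b.src, b.dir⟩ : PBond (F.P Kt) (k i)) ∉ bondsOf (pts (k i) (Λ i)))
    : ∀ i (Vk : GaugeField (F.P Kt) (k i) SU2), PlaqSmallOn (plaqsInside (pts (k i) (Z i ∩ (Λ i)ᶜ))) (eR i) Vk →
      ∀ X : GaugeSlice (pts (k i) (Λ i)) (T i) E3,
        γ / (M i) ^ 5 * ‖X‖ ^ 2 ≤ ⟪X, (fderiv ℝ (rGrad (pts (k i) (Λ i)) (T i)
          (sliceFn (pts (k i) (Λ i)) (T i)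
            (fun177stdB (Node00.bgMSCoPOfRecordB F 2 ν Kt (k i) (maxDomT ν.M₁ (Z i))) ν.M₁ bd (Z i) (k i)) (ext i Vk))) 0) X⟫_ℝ := by
  intro i Vk hV X
  -- the box is non-wrapping with margin (from `hN5`)
  have hN : ∀ κ, hi i κ - lo i κ + 3 < ((F.P Kt).sitesPerDir (k i) : ℤ) := fun κ => by
    have h5 := hN5 i κ
    have : hi i κ - lo i κ + 1 ≤ ((hi i κ - lo i κ + 1).toNat : ℤ) := Int.self_le_toNat _
    linarith
  refine B15Prop1CoerciveAtNormalisedDatum.sliceCoercive_fun177stdB_bgMSCoPOfRecordB_of_normalised ν Kt (k i) (maxDomT ν.M₁ (Z i)) ν.M₁ bd (Z i) hd3 (hk i) (hbd i) (hlohi i)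
    (hn i) hN (hbox i) (hZ i) (hLO i) (hHI i) (hn' i) (hn'N i) (hR i) (heR i) (hρn i) (ext i) (hext i) (T i) (γ / (M i) ^ 5)
    (fun V hV' hnV X' => ?_) Vk hV X
  -- (1.9) at a normalised base field from the window∕direct package there (§3)
  obtain ⟨U₀, Xf, W, hUwin, hPfar, hX₀, hXc, hmin, Ψ₂, lam, p, hΨ₂, hΨd, hlam, hp, hX⟩ := hWD i V hV' hnV
  exact sliceCoercive_of_windowLetters_direct ν Kt hd3 h0 (hk i) bd (Z i) (Λ i) (T i) (hbox i) (hTG0 i) (hN5 i) (hK1 i) (hKn i)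
    (ext i) V (S i) (hS i) (hfar i) hγ₀ (hδc0 i) (hεc0 i) (hμc0 i) U₀ W hUwin hPfar Xf hX₀ hXc hmin hΨ₂ hΨd hlam p hp hX (hsm i) (hγle i) X'

end

end Literature.MathematicalPhysics.QuantumFieldTheory.Balaban1983to89.B15Prop1EndpointNearFlatLettersWindowB

end
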